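import Literature.AnabelianGeometry.SemiGraphs.TemperedEdgeLikeCentralizerOfSeparated
import Literature.AnabelianGeometry.SemiGraphs.TemperedEdgeLikeCentralizerOfTopCyclic
import HarnessLib

/-!
# [SemiAnbd] Cor 3.9 (R3c): the LEVEL TEST for hostability on the canonical tower, and
# `EdgeLikeCentralizerAt` from level separation (proof-only)

Mochizuki, *Semi-graphs of anabelioids*, Publ. RIMS **42** (2006), §3, Theorem 3.7 (iii) p. 41 ("a compatible
system of closed edges fixed by `H` … `H` is contained in some edge-like subgroup") and Corollary 3.9, proof
p. 43 l. 13 (the cell's step (R3c), FACT-LIST rows F-2772 `EdgeLikeCentralizerAt` / F-2773 `EdgeLikeCentralizer`)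
[cite: MochizukiSemiAnbd2006, Cor 3.9 p.43].

PROOF-ONLY (cell abc-iut, block F, seat abc-iut-f-176 gen 6, sequel to `TemperedEdgeLikeCentralizerOfSeparated`; no
definition, no named fact).  The finite-hostable criterion of the prequel asks, for an open edge piece `C`, that
only finitely many edges `e′` carry an edge-like subgroup `L ⊇ C`.  Here the quantifier over the edge-like subgroups
of `π₁^temp(G)` is replaced by a check at ONE LEVEL of the canonical tower `𝔾̃_n` of abc-iut-L3-t9/d4
(`galoisLevelData`):
* `not_exists_edgeLike_ge_of_level_unfixed` — **the LEVEL TEST**: if at some level `n` NO edge of the tree `𝔾̃_n`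
  lying over `e′` is fixed by every element of `C`, then no edge-like subgroup at `e′` contains `C` (an edge-like
  `L ⊇ C` makes `C` fix the tree edges `Q.edge n` of an edge-point sequence `Q` over `e′` at EVERY level —
  abc-iut-f-172 gen 7's `exists_edgeSeq_fixing_of_le_of_mem_edgeLikeSubgroups` — and `Q.edge n` lies over `e′`);
  `not_exists_edgeLike_ge_of_level_unfixed_edge` is the edge form for graphs.
* `finite_hostable_of_level_separated` — if every edge outside a finite set fails the level test at some level,
  the `C`-hostable edges are finite.
* `centralizer_le_verticial_of_level_separated` / `edgeLikeCentralizerAt_of_level_separated` — **(R3c) at the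
  canonical chart of every Cor-3.9 graph in which, for every open edge piece `ψ(U)`, all but finitely many edges
  `e′` admit a level `n` at which `ψ(U)` fixes no tree edge over `e′`** (prequel's
  `centralizer_le_verticial_of_finite_hostable`); any underlying graph, any edge groups.

Honest framing: statements about OUR typed tempered fundamental groups; the bare ∀-closure F-2773 is NOT claimed
(its residual: an open edge piece fixing, at EVERY level, some tree edge over each of infinitely many edges);
cone-irrelevant beyond finite dual graphs; no side taken on [IUTchIII] Cor. 3.12; typed ≠ proved elsewhere.
-/

namespace Literature.AnabelianGeometry.SemiGraphs

namespace ProfiniteSemiGraph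

open CategoryTheory Topology

universe u

variable (𝒢 : ProfiniteSemiGraph.{u}) (h37 : 𝒢.Thm37Hypotheses)

/-- **The LEVEL TEST for hostability** (canonical chart).  Let `C` be any subgroup of `π₁^temp(G)` and `b` a
branch of the edge `e′` abutting to `w`.  If at some level `n` of the canonical tower every tree edge of `𝔾̃_n`
lying over `e′` is moved by some element of `C`, then NO edge-like subgroup at `e′` contains `C`: an edge-like
`L ⊇ C` would make `C` fix the edges `Q.edge n` (over `e′`) of an edge-point sequence `Q` at every level.
[cite: MochizukiSemiAnbd2006, Thm 3.7(iii) p.41] -/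
theorem not_exists_edgeLike_ge_of_level_unfixed
    (C : Subgroup (𝒢.temperedPiChart h37.toProp36Hypotheses).G) {b : 𝒢.graph.Branch} {w : 𝒢.graph.Vertex}
    (hb : 𝒢.graph.abuts b = some w)
    (h : ∃ n : ℕ, ∀ ε : ((𝒢.galoisLevelData h37.toProp36Hypotheses).tree n).Edge,
      ((𝒢.galoisLevelData h37.toProp36Hypotheses).treeProj n).edgeMap ε = 𝒢.graph.edgeOf b →
        ∃ g ∈ C, ((𝒢.galoisLevelData h37.toProp36Hypotheses).treeAct
          h37.toProp36Hypotheses.isCountable n g).hom.edgeMap ε ≠ ε) :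
    ¬ ∃ L ∈ edgeLikeSubgroups (𝒢.temperedPiChart h37.toProp36Hypotheses) (𝒢.graph.edgeOf b), C ≤ L := by
  rintro ⟨L, hL, hCL⟩
  obtain ⟨n, hn⟩ := h
  obtain ⟨Q, hQ⟩ := 𝒢.exists_edgeSeq_fixing_of_le_of_mem_edgeLikeSubgroups h37 C L hb hL hCL
  obtain ⟨g, hg, hne⟩ := hn (Q.edge n) (Q.treeProj_edgeMap_edge n)
  exact hne (hQ g hg n)

/-- **The level test, edge form** (graphs: every edge has a branch abutting to a vertex).
[cite: MochizukiSemiAnbd2006, Thm 3.7(iii) p.41] -/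
theorem not_exists_edgeLike_ge_of_level_unfixed_edge (hG : 𝒢.IsGraph)
    (C : Subgroup (𝒢.temperedPiChart h37.toProp36Hypotheses).G) (e' : 𝒢.graph.Edge)
    (h : ∃ n : ℕ, ∀ ε : ((𝒢.galoisLevelData h37.toProp36Hypotheses).tree n).Edge,
      ((𝒢.galoisLevelData h37.toProp36Hypotheses).treeProj n).edgeMap ε = e' →
        ∃ g ∈ C, ((𝒢.galoisLevelData h37.toProp36Hypotheses).treeAct
          h37.toProp36Hypotheses.isCountable n g).hom.edgeMap ε ≠ ε) :
    ¬ ∃ L ∈ edgeLikeSubgroups (𝒢.temperedPiChart h37.toProp36Hypotheses) e', C ≤ L := by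
  obtain ⟨b, -, -, hbe, -, -⟩ := 𝒢.graph.two_branches e'
  obtain ⟨w, hw⟩ := Option.isSome_iff_exists.mp (hG.abuts_isSome b)
  subst hbe
  exact 𝒢.not_exists_edgeLike_ge_of_level_unfixed h37 C hw h

/-- **Level separation outside a finite set ⇒ finitely many hostable edges** (canonical chart): if every
edge outside a finite set `E₀` admits a level at which `C` fixes no tree edge over it, the edges carrying an
edge-like subgroup `L ⊇ C` lie in `E₀`. [cite: MochizukiSemiAnbd2006, Thm 3.7(iii) p.41] -/
theorem finite_hostable_of_level_separated (hG : 𝒢.IsGraph)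
    (C : Subgroup (𝒢.temperedPiChart h37.toProp36Hypotheses).G) {E₀ : Set 𝒢.graph.Edge} (hE₀ : E₀.Finite)
    (hsep : ∀ e' ∉ E₀, ∃ n : ℕ, ∀ ε : ((𝒢.galoisLevelData h37.toProp36Hypotheses).tree n).Edge,
      ((𝒢.galoisLevelData h37.toProp36Hypotheses).treeProj n).edgeMap ε = e' →
        ∃ g ∈ C, ((𝒢.galoisLevelData h37.toProp36Hypotheses).treeAct
          h37.toProp36Hypotheses.isCountable n g).hom.edgeMap ε ≠ ε) :
    {e' : 𝒢.graph.Edge | ∃ L ∈ edgeLikeSubgroups (𝒢.temperedPiChart h37.toProp36Hypotheses) e', C ≤ L}.Finite := by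
  refine hE₀.subset fun e' he' => ?_
  by_contra hmem
  exact 𝒢.not_exists_edgeLike_ge_of_level_unfixed_edge h37 hG C e' (hsep e' hmem) he'

/-- **The centraliser of a nontrivial compact `C` lies in every verticial host when all but finitely many
edges are level-separated from `C`** (canonical chart; prequel's `centralizer_le_verticial_of_finite_hostable`).
[cite: MochizukiSemiAnbd2006, Thm 3.7(iii) pp.40-41] -/
theorem centralizer_le_verticial_of_level_separated (hG : 𝒢.IsGraph)
    (C : Subgroup (𝒢.temperedPiChart h37.toProp36Hypotheses).G)
    (hCc : IsCompact (C : Set (𝒢.temperedPiChart h37.toProp36Hypotheses).G)) (hC : C ≠ ⊥)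
    {E₀ : Set 𝒢.graph.Edge} (hE₀ : E₀.Finite)
    (hsep : ∀ e' ∉ E₀, ∃ n : ℕ, ∀ ε : ((𝒢.galoisLevelData h37.toProp36Hypotheses).tree n).Edge,
      ((𝒢.galoisLevelData h37.toProp36Hypotheses).treeProj n).edgeMap ε = e' →
        ∃ g ∈ C, ((𝒢.galoisLevelData h37.toProp36Hypotheses).treeAct
          h37.toProp36Hypotheses.isCountable n g).hom.edgeMap ε ≠ ε)
    {v : 𝒢.graph.Vertex} {H : Subgroup (𝒢.temperedPiChart h37.toProp36Hypotheses).G}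
    (hH : H ∈ verticialSubgroups (𝒢.temperedPiChart h37.toProp36Hypotheses) v) (hCH : C ≤ H) :
    Subgroup.centralizer (C : Set (𝒢.temperedPiChart h37.toProp36Hypotheses).G) ≤ H :=
  centralizer_le_verticial_of_finite_hostable h37 _ C hCc hC
    (𝒢.finite_hostable_of_level_separated h37 hG C hE₀ hsep) hH hCH

/-- **(R3c) F-2772 `EdgeLikeCentralizerAt` at the CANONICAL chart of every Cor-3.9 graph of anabelioids in which
every open edge piece is LEVEL-SEPARATED from all but finitely many edges** (p. 43 l. 13): for every edge
homomorphism `ψ` at `e` and open `U ≤ Π_e` there is a finite set of edges outside which each edge `e′` admits a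
level `n` of the canonical tower at which `ψ(U)` fixes no tree edge over `e′`.  Any underlying graph, any edge
groups; the bare ∀-closure F-2773 is not claimed. [cite: MochizukiSemiAnbd2006, Cor 3.9 p.43] -/
theorem edgeLikeCentralizerAt_of_level_separated (h𝒢 : Cor39Hypotheses 𝒢)
    (hsep : ∀ (e : 𝒢.graph.Edge) (ψ : 𝒢.Ge e →ₜ* (𝒢.temperedPiChart h𝒢.toProp36Hypotheses).G),
      IsEdgeHom (𝒢.temperedPiChart h𝒢.toProp36Hypotheses) e ψ →
      ∀ (U : Subgroup (𝒢.Ge e)), IsOpen (U : Set (𝒢.Ge e)) →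
      ∃ E₀ : Set 𝒢.graph.Edge, E₀.Finite ∧
        ∀ e' ∉ E₀, ∃ n : ℕ, ∀ ε : ((𝒢.galoisLevelData h𝒢.toProp36Hypotheses).tree n).Edge,
          ((𝒢.galoisLevelData h𝒢.toProp36Hypotheses).treeProj n).edgeMap ε = e' →
            ∃ g ∈ U.map ψ.toMonoidHom, ((𝒢.galoisLevelData h𝒢.toProp36Hypotheses).treeAct
              h𝒢.toProp36Hypotheses.isCountable n g).hom.edgeMap ε ≠ ε) :
    EdgeLikeCentralizerAt 𝒢 (𝒢.temperedPiChart h𝒢.toProp36Hypotheses) := by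
  refine edgeLikeCentralizerAt_of_finite_hostable h𝒢 _ fun e ψ hψ U hU => ?_
  obtain ⟨E₀, hE₀, hE₀sep⟩ := hsep e ψ hψ U hU
  exact 𝒢.finite_hostable_of_level_separated h𝒢.thm37Hypotheses h𝒢.isGraph _ hE₀ hE₀sep

end ProfiniteSemiGraph

end Literature.AnabelianGeometry.SemiGraphs
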